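import Mathlib.Analysis.SpecialFunctions.Pow.Deriv
import Literature.Analysis.SingularIntegrals.SchurTest
import Literature.Analysis.SingularIntegrals.CalderonZygmundLp
import Literature.Analysis.FluidPDE.NewtonPotentialHolder
import HarnessLib

/-!
# Stein's theorem on singular integrals with power weights (`ℝ³`)

Analysis/SingularIntegrals file (everything proved) on the discharge path of the named fact
`Literature.Analysis.FluidPDE.grafakos2014_normalisedPressure_powerWeight_bound`
(`FluidPDE/NormalisedPressurePowerWeightBound`): the power-weighted `L^p` inequality for the
Riesz-type operator of the normalised pressure, `‖p̃[w]‖_{L^p(|x|^β)} ≤ C ‖|w|²‖_{L^p(|x|^β)}`,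
`-3 < β < 3(p-1)`. Grafakos (2014, Thm 7.4.6 with Ex. 7.1.7) obtains it from the `A_p` theory;
historically — and far more economically given the tree's proved unweighted Calderón–Zygmund
theory (`SingularIntegrals/CalderonZygmundLp`) — the power-weight case is

**E. M. Stein, *Note on singular integrals*, Proc. Amer. Math. Soc. 8 (1957) 250–254.**

* **Lemma** (p. 250–251). *Let `K(x,y) = |1 - (|x|/|y|)^α| / |x-y|ⁿ` and
  `U(f)(x) = ∫ K(x,y) f(y) dy`. Then `‖U(f)‖_p ≤ A_{p,α} ‖f‖_p` if `-n/p < α < n/p'`.*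
* **Theorem** (p. 250, proved in §3, p. 254). *Let `(Tf)(x) = p.v.∫ H(x,x-y)|x-y|⁻ⁿ f(y) dy`,
  assume `‖T(f)‖_p ≤ A_p ‖f‖_p` and `|H(x,x-y)| ≤ A`. Then `‖(Tf)(x)|x|^α‖_p ≤ A_{p,α} ‖f(x)|x|^α‖_p`
  if `-n/p < α < n/p'`.* Proof (§3): with `F = T[f]`, `F* = T[|y|^α f]`,
  `|F*(x) - |x|^α F(x)| = |∫ H |x-y|⁻ⁿ [1 - (|x|/|y|)^α] |y|^α f(y) dy| ≤ A ∫ K(x,y) |y|^α |f(y)| dy`,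
  and the Lemma applies.

This file proves both on `ℝ³` (`n = 3`, the case the tree needs), for convolution operators
`Tf(x) = ∫ f(t) k(x-t) dt` with a bounded measurable kernel `k` satisfying `|k(z)| ≤ A|z|⁻³`
(the setting of `SingularIntegrals.exists_eLpNorm_le`, whose conclusion — an `L^p` bound on
bounded compactly supported measurable `f` — is exactly the hypothesis "`‖T(f)‖_p ≤ A_p‖f‖_p`"
used here).

## The proof of the Lemma (Schur's test instead of Stein's rotations)

Stein integrates in polar coordinates and uses the Poisson kernel of the sphere near the
singularity `|x| = |y|`. We use instead Schur's test (`SingularIntegrals/SchurTest`) with the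
power test functions `u = v = |x|^{-3/(pp')}`: by the homogeneity `K(λx,λy) = λ⁻³K(x,y)` the
row and column integrals reduce, after the substitution `y = |x| s`, to
`|x|^{-3/p} J_{-α,3/p}(x/|x|)` and `|y|^{-3/p'} J_{α,3/p'}(y/|y|)`, where
`J_{γ,σ}(e) = ∫ ||s|^γ - 1| |s|^{-σ} |e-s|⁻³ ds` (`|e| = 1`). `J_{γ,σ}` is bounded uniformly in
`e` when `0 < σ < 3` and `0 < σ - γ < 3` (`exists_lintegral_steinIntegrand_le`): on `|s| < 1/2`
use `|e-s| ≥ 1/2`, on `|s| ≥ 2` use `|e-s| ≥ |s|/2` (radial power integrals of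
`FluidPDE/NewtonPotentialHolder`), and on `1/2 ≤ |s| ≤ 2` the Lipschitz bound
`||s|^γ - 1| ≤ L ||s| - 1| ≤ L |s - e|` (mean value theorem) leaves the integrable singularity
`|s-e|⁻²`. For rows and columns these conditions read exactly `-3/p < α < 3/p'`.

## Main statements

* `steinKernel α x t = ||x|^α - |t|^α| |t|^{-α} |x-t|⁻³` (`= K(x,t)` of the Lemma) and
  `steinIntegrand γ σ e s = ||s|^γ - 1| |s|^{-σ} |e-s|⁻³`.
* `exists_lintegral_steinIntegrand_le`: `sup_{|e|=1} J_{γ,σ}(e) < ∞`.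
* `lintegral_steinKernel_row`, `lintegral_steinKernel_col`: the scaling reductions.
* `stein1957_lemma`: **Stein's Lemma** on `ℝ³` in `lintegral` form,
  `∫ (∫ K(x,t) f(t) dt)^p dx ≤ C ∫ f^p` for `-3/p < α < 3/p'`.
* `eLpNorm_le_of_integrable`: an `L^p` bound for `Tf = ∫ f(t)k(·-t)dt` (`k` bounded) on bounded
  compactly supported measurable `f` extends to integrable compactly supported measurable `f`
  (truncation, dominated convergence, Fatou) — needed for `|t|^α f` with `α < 0`.
* `stein1957_powerWeight`: **Stein's Theorem** on `ℝ³`: if `|k(z)| ≤ A|z|⁻³` (`z ≠ 0`) and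
  `‖Tf‖_p ≤ C_p ‖f‖_p` on bounded compactly supported measurable `f`, then
  `‖|x|^α T h‖_p ≤ (C_p + A C) ‖|x|^α h‖_p` for such `h`, `-3/p < α < 3/p'`, with `C = C(p, α)`.

## Mathlib / tree search

Mathlib: `Real.rpow` calculus (`Real.hasDerivAt_rpow_const`,
`Convex.norm_image_sub_le_of_norm_deriv_le`), `Measure.map_addHaar_smul` (scaling),
`ENNReal.lintegral_Lp_add_le` (Minkowski), `tendsto_integral_of_dominated_convergence`,
`Lp.eLpNorm_lim_le_liminf_eLpNorm` (Fatou) — used; no weighted singular-integral estimates.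
Tree: `SchurTest` (`lintegral_rpow_lintegral_le_of_schur`); `NewtonPotentialHolder`
(`lintegral_ball_norm_rpow_neg`, `lintegral_compl_ball_norm_rpow_neg`,
`lintegral_ball_comp_sub_left`, `integrableOn_ball_norm_rpow_neg`); `CalderonZygmundWeakType`
(`integrable_mul_kernel`, `stronglyMeasurable_integral_mul_kernel`,
`integrable_of_bdd_of_hasCompactSupport`).

## References

* E. M. Stein, *Note on singular integrals*, Proc. Amer. Math. Soc. 8 (1957) 250–254: Lemma
  (pp. 250–251) and Theorem (p. 250; proof §3, p. 254) [Stein1957].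
* L. Grafakos, *Modern Fourier Analysis*, 2nd ed. (2009), Appendix A.2 (Schur's lemma)
  [Grafakos2009].
* L. Grafakos, *Classical Fourier Analysis*, 3rd ed. (2014), §7.4.3–7.4.4 and the historical
  note p. 525 ("Weighted inequalities with weights of the form `|x|^a` … were first obtained by
  Hardy and Littlewood … and later by Stein [332] for other singular integrals") [Grafakos2014].
-/

noncomputable section

open MeasureTheory Metric Set Filter Function Topology
open scoped ENNReal NNReal

namespace Literature.Analysis.SingularIntegrals

/-- Local notation for `ℝ³ = EuclideanSpace ℝ (Fin 3)`. -/
local notation "ℝ³" => EuclideanSpace ℝ (Fin 3)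

/-! ## §1. Stein's kernel and the angular–radial integrand -/

section Definitions

/-- **Stein's kernel** `K(x,t) = |1 - (|x|/|t|)^α| / |x-t|³` on `ℝ³` (Stein 1957, Lemma), written
as `||x|^α - |t|^α| · |t|^{-α} · (|x-t|³)⁻¹` (equal to Stein's expression for `t ≠ 0`; junk values
on the null set `{t = 0} ∪ {t = x}` by the conventions `0⁻¹ = 0`, `0^s = 0`). [cite: Stein1957, Lemma p. 250] -/
def steinKernel (α : ℝ) (x t : ℝ³) : ℝ := |‖x‖ ^ α - ‖t‖ ^ α| * ‖t‖ ^ (-α) * (‖x - t‖ ^ 3)⁻¹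

/-- The angular–radial integrand `||s|^γ - 1| |s|^{-σ} |e - s|⁻³` to which the row (`γ = -α`,
`σ = 3/p`) and column (`γ = α`, `σ = 3/p'`) integrals of Schur's test for `steinKernel α` reduce
after scaling (Stein 1957, (2)–(3): the kernel `K(ξ, λη)` on the unit sphere). [cite: Stein1957, §2 (2)–(3)] -/
def steinIntegrand (γ σ : ℝ) (e s : ℝ³) : ℝ := |‖s‖ ^ γ - 1| * ‖s‖ ^ (-σ) * (‖e - s‖ ^ 3)⁻¹

/-- Stein's kernel is nonnegative. [folklore] -/
theorem steinKernel_nonneg (α : ℝ) (x t : ℝ³) : 0 ≤ steinKernel α x t := by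
  unfold steinKernel; positivity

/-- The angular–radial integrand is nonnegative. [folklore] -/
theorem steinIntegrand_nonneg (γ σ : ℝ) (e s : ℝ³) : 0 ≤ steinIntegrand γ σ e s := by
  unfold steinIntegrand; positivity

/-- Joint measurability of Stein's kernel. [folklore] -/
theorem measurable_steinKernel (α : ℝ) : Measurable fun z : ℝ³ × ℝ³ => steinKernel α z.1 z.2 := by
  unfold steinKernel
  refine Measurable.mul (Measurable.mul ?_ ?_) ?_
  · exact ((measurable_fst.norm.pow_const α).sub (measurable_snd.norm.pow_const α)).abs
  · exact measurable_snd.norm.pow_const _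
  · exact ((measurable_fst.sub measurable_snd).norm.pow_const _).inv

/-- Measurability of the angular–radial integrand in `s`. [folklore] -/
theorem measurable_steinIntegrand (γ σ : ℝ) (e : ℝ³) : Measurable (steinIntegrand γ σ e) := by
  unfold steinIntegrand
  refine Measurable.mul (Measurable.mul ?_ ?_) ?_
  · exact ((measurable_norm.pow_const γ).sub measurable_const).abs
  · exact measurable_norm.pow_const _
  · exact ((measurable_const.sub measurable_id).norm.pow_const _).inv

end Definitions

/-! ## §2. The angular–radial integral is bounded uniformly on the unit sphere -/

section Angular

/-- Powers on `[1/2, 2]`: `r^δ ≤ 2^{|δ|}`. [folklore] -/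
theorem rpow_le_two_rpow_abs {r : ℝ} (hr1 : 1 / 2 ≤ r) (hr2 : r ≤ 2) (δ : ℝ) :
    r ^ δ ≤ (2 : ℝ) ^ |δ| := by
  have hr0 : 0 < r := lt_of_lt_of_le (by norm_num) hr1
  rcases le_or_gt 0 δ with hδ | hδ
  · rw [abs_of_nonneg hδ]
    exact Real.rpow_le_rpow hr0.le hr2 hδ
  · rw [abs_of_neg hδ]
    calc r ^ δ ≤ (1 / 2 : ℝ) ^ δ := Real.rpow_le_rpow_of_nonpos (by norm_num) hr1 hδ.le
      _ = (2 : ℝ) ^ (-δ) := by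
          rw [one_div, Real.inv_rpow (by norm_num : (0 : ℝ) ≤ 2), Real.rpow_neg (by norm_num : (0 : ℝ) ≤ 2)]

/-- **Lipschitz bound for powers near `1`** (mean value theorem): for `1/2 ≤ r ≤ 2`,
`|r^γ - 1| ≤ |γ| 2^{|γ-1|} |r - 1|`. [folklore] -/
theorem abs_rpow_sub_one_le {r : ℝ} (hr1 : 1 / 2 ≤ r) (hr2 : r ≤ 2) (γ : ℝ) :
    |r ^ γ - 1| ≤ |γ| * (2 : ℝ) ^ |γ - 1| * |r - 1| := by
  have hconv : Convex ℝ (Icc (1 / 2 : ℝ) 2) := convex_Icc _ _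
  have hd : ∀ x ∈ Icc (1 / 2 : ℝ) 2, DifferentiableAt ℝ (fun x : ℝ => x ^ γ) x := fun x hx =>
    (Real.hasDerivAt_rpow_const (Or.inl (lt_of_lt_of_le (by norm_num) hx.1).ne')).differentiableAt
  have hb : ∀ x ∈ Icc (1 / 2 : ℝ) 2, ‖deriv (fun x : ℝ => x ^ γ) x‖ ≤ |γ| * (2 : ℝ) ^ |γ - 1| := by
    intro x hx
    rw [Real.deriv_rpow_const, Real.norm_eq_abs, abs_mul]
    gcongr
    rw [abs_of_nonneg (Real.rpow_nonneg (le_trans (by norm_num) hx.1) _)]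
    exact rpow_le_two_rpow_abs hx.1 hx.2 _
  have h := hconv.norm_image_sub_le_of_norm_deriv_le hd hb
    (show (1 : ℝ) ∈ Icc (1 / 2 : ℝ) 2 by constructor <;> norm_num) ⟨hr1, hr2⟩
  simp only [Real.one_rpow, Real.norm_eq_abs] at h
  exact h

/-- Bound on the inner region `|s| < 1/2` (`|e| = 1`): `|e - s| ≥ 1/2`, so
`steinIntegrand ≤ 8 (|s|^{-(σ-γ)} + |s|^{-σ})`. [cite: Stein1957, §2 (3)] -/
theorem steinIntegrand_le_of_norm_lt_half {γ σ : ℝ} (hσ : 0 < σ) {e s : ℝ³} (he : ‖e‖ = 1)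
    (hs : ‖s‖ < 1 / 2) :
    steinIntegrand γ σ e s ≤ 8 * (‖s‖ ^ (-(σ - γ)) + ‖s‖ ^ (-σ)) := by
  rcases eq_or_ne s 0 with rfl | hs0
  · simp only [steinIntegrand, norm_zero, Real.zero_rpow (neg_ne_zero.2 hσ.ne'), mul_zero, zero_mul]
    positivity
  have hsp : 0 < ‖s‖ := norm_pos_iff.2 hs0
  have hes : 1 / 2 ≤ ‖e - s‖ := by
    have := norm_sub_norm_le e s
    linarith
  have hinv : (‖e - s‖ ^ 3)⁻¹ ≤ 8 := by
    rw [inv_le_comm₀ (by positivity) (by norm_num)]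
    calc (8 : ℝ)⁻¹ = (1 / 2) ^ 3 := by norm_num
      _ ≤ ‖e - s‖ ^ 3 := pow_le_pow_left₀ (by norm_num) hes 3
  have habs : |‖s‖ ^ γ - 1| ≤ ‖s‖ ^ γ + 1 := by
    calc |‖s‖ ^ γ - 1| ≤ |‖s‖ ^ γ| + |(1 : ℝ)| := abs_sub _ _
      _ = ‖s‖ ^ γ + 1 := by rw [abs_of_nonneg (Real.rpow_nonneg hsp.le _), abs_one]
  unfold steinIntegrand
  calc |‖s‖ ^ γ - 1| * ‖s‖ ^ (-σ) * (‖e - s‖ ^ 3)⁻¹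
      ≤ (‖s‖ ^ γ + 1) * ‖s‖ ^ (-σ) * 8 := by gcongr
    _ = 8 * (‖s‖ ^ (-(σ - γ)) + ‖s‖ ^ (-σ)) := by
        rw [show -(σ - γ) = γ + -σ by ring, Real.rpow_add hsp]
        ring

/-- Bound on the outer region `|s| ≥ 2` (`|e| = 1`): `|e - s| ≥ |s|/2`, so
`steinIntegrand ≤ 8 (|s|^{-(σ-γ+3)} + |s|^{-(σ+3)})`. [cite: Stein1957, §2 p. 252–253] -/
theorem steinIntegrand_le_of_two_le_norm {γ σ : ℝ} {e s : ℝ³} (he : ‖e‖ = 1) (hs : 2 ≤ ‖s‖) :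
    steinIntegrand γ σ e s ≤ 8 * (‖s‖ ^ (-(σ - γ + 3)) + ‖s‖ ^ (-(σ + 3))) := by
  have hsp : 0 < ‖s‖ := lt_of_lt_of_le (by norm_num) hs
  have hes : ‖s‖ / 2 ≤ ‖e - s‖ := by
    have h1 : ‖s‖ - ‖e‖ ≤ ‖e - s‖ := by rw [norm_sub_rev]; exact norm_sub_norm_le s e
    rw [he] at h1
    linarith
  have hinv : (‖e - s‖ ^ 3)⁻¹ ≤ 8 * ‖s‖ ^ (-(3 : ℝ)) := by
    rw [Real.rpow_neg hsp.le, show (3 : ℝ) = ((3 : ℕ) : ℝ) by norm_num, Real.rpow_natCast,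
      show (8 : ℝ) * (‖s‖ ^ 3)⁻¹ = ((‖s‖ / 2) ^ 3)⁻¹ by field_simp; ring]
    exact inv_anti₀ (by positivity) (pow_le_pow_left₀ (by positivity) hes 3)
  have habs : |‖s‖ ^ γ - 1| ≤ ‖s‖ ^ γ + 1 := by
    calc |‖s‖ ^ γ - 1| ≤ |‖s‖ ^ γ| + |(1 : ℝ)| := abs_sub _ _
      _ = ‖s‖ ^ γ + 1 := by rw [abs_of_nonneg (Real.rpow_nonneg hsp.le _), abs_one]
  unfold steinIntegrand
  calc |‖s‖ ^ γ - 1| * ‖s‖ ^ (-σ) * (‖e - s‖ ^ 3)⁻¹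
      ≤ (‖s‖ ^ γ + 1) * ‖s‖ ^ (-σ) * (8 * ‖s‖ ^ (-(3 : ℝ))) := by gcongr
    _ = 8 * (‖s‖ ^ (-(σ - γ + 3)) + ‖s‖ ^ (-(σ + 3))) := by
        rw [show -(σ - γ + 3) = γ + -σ + -(3 : ℝ) by ring, show -(σ + 3) = -σ + -(3 : ℝ) by ring,
          Real.rpow_add hsp, Real.rpow_add hsp, Real.rpow_add hsp]
        ring

/-- Bound on the middle region `1/2 ≤ |s| ≤ 2` (`|e| = 1`), where the singularity `s = e` lives:
`||s|^γ - 1| ≤ L ||s| - 1| ≤ L |e - s|` and `|s|^{-σ} ≤ 2^σ`, so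
`steinIntegrand ≤ L 2^σ |e - s|⁻²`, `L = |γ| 2^{|γ-1|}`. [cite: Stein1957, §2 (9)–(13)] -/
theorem steinIntegrand_le_of_mem_shell {γ σ : ℝ} (hσ : 0 < σ) {e s : ℝ³} (he : ‖e‖ = 1)
    (hs1 : 1 / 2 ≤ ‖s‖) (hs2 : ‖s‖ ≤ 2) :
    steinIntegrand γ σ e s ≤ |γ| * (2 : ℝ) ^ |γ - 1| * (2 : ℝ) ^ σ * ‖e - s‖ ^ (-(2 : ℝ)) := by
  have hsp : 0 < ‖s‖ := lt_of_lt_of_le (by norm_num) hs1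
  set L : ℝ := |γ| * (2 : ℝ) ^ |γ - 1| with hL
  have hL0 : 0 ≤ L := by positivity
  have h1 : |‖s‖ ^ γ - 1| ≤ L * ‖e - s‖ := by
    refine (abs_rpow_sub_one_le hs1 hs2 γ).trans ?_
    rw [← hL]
    refine mul_le_mul_of_nonneg_left ?_ hL0
    calc |‖s‖ - 1| = |‖s‖ - ‖e‖| := by rw [he]
      _ ≤ ‖s - e‖ := abs_norm_sub_norm_le s e
      _ = ‖e - s‖ := norm_sub_rev _ _
  have h2 : ‖s‖ ^ (-σ) ≤ (2 : ℝ) ^ σ := by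
    calc ‖s‖ ^ (-σ) ≤ (1 / 2 : ℝ) ^ (-σ) :=
          Real.rpow_le_rpow_of_nonpos (by norm_num) hs1 (neg_nonpos.2 hσ.le)
      _ = (2 : ℝ) ^ σ := by
          rw [one_div, Real.inv_rpow (by norm_num : (0 : ℝ) ≤ 2), Real.rpow_neg (by norm_num : (0 : ℝ) ≤ 2),
            inv_inv]
  have h3 : ‖e - s‖ * (‖e - s‖ ^ 3)⁻¹ ≤ ‖e - s‖ ^ (-(2 : ℝ)) := by
    rcases eq_or_ne (‖e - s‖) 0 with h0 | h0
    · rw [h0, zero_mul]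
      exact Real.rpow_nonneg le_rfl _
    · have hd : 0 < ‖e - s‖ := (norm_nonneg _).lt_of_ne' h0
      rw [Real.rpow_neg hd.le, show (2 : ℝ) = ((2 : ℕ) : ℝ) by norm_num, Real.rpow_natCast]
      rw [show ‖e - s‖ * (‖e - s‖ ^ 3)⁻¹ = (‖e - s‖ ^ 2)⁻¹ by field_simp]
  unfold steinIntegrand
  calc |‖s‖ ^ γ - 1| * ‖s‖ ^ (-σ) * (‖e - s‖ ^ 3)⁻¹
      ≤ (L * ‖e - s‖) * (2 : ℝ) ^ σ * (‖e - s‖ ^ 3)⁻¹ := by gcongr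
    _ = L * (2 : ℝ) ^ σ * (‖e - s‖ * (‖e - s‖ ^ 3)⁻¹) := by ring
    _ ≤ L * (2 : ℝ) ^ σ * ‖e - s‖ ^ (-(2 : ℝ)) := by gcongr

/-- **The angular–radial integral is bounded on the unit sphere** (the convergence conditions of
Stein 1957, §2: (7) "if `β < n/p'`" and p. 253 "which clearly converges if `β > -n/p`", here in
the symmetric form `0 < σ < 3`, `0 < σ - γ < 3`): there is `C` with
`∫ ||s|^γ - 1| |s|^{-σ} |e-s|⁻³ ds ≤ C` for all unit vectors `e`. [cite: Stein1957, Lemma, §2] -/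
theorem exists_lintegral_steinIntegrand_le {γ σ : ℝ} (hσ : 0 < σ) (hσ3 : σ < 3) (hγ : 0 < σ - γ)
    (hγ3 : σ - γ < 3) :
    ∃ C : ℝ≥0, ∀ e : ℝ³, ‖e‖ = 1 → ∫⁻ s, ENNReal.ofReal (steinIntegrand γ σ e s) ≤ C := by
  set v₁ : ℝ := (volume : Measure ℝ³).real (ball 0 1) with hv₁
  set L : ℝ := |γ| * (2 : ℝ) ^ |γ - 1| * (2 : ℝ) ^ σ with hL
  -- the three regions
  set B : Set ℝ³ := ball 0 (1 / 2) with hB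
  set F : Set ℝ³ := (ball (0 : ℝ³) 2)ᶜ with hF
  set M : Set ℝ³ := {s : ℝ³ | 1 / 2 ≤ ‖s‖ ∧ ‖s‖ ≤ 2} with hM
  have hBm : MeasurableSet B := measurableSet_ball
  have hFm : MeasurableSet F := measurableSet_ball.compl
  have hMm : MeasurableSet M :=
    (measurableSet_le measurable_const measurable_norm).inter (measurableSet_le measurable_norm measurable_const)
  have hcover : B ∪ M ∪ F = univ := by
    refine eq_univ_of_forall fun s => ?_
    simp only [hB, hM, hF, mem_union, mem_ball_zero_iff, mem_setOf_eq, mem_compl_iff, not_lt]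
    rcases lt_or_ge ‖s‖ (1 / 2) with h | h
    · exact Or.inl (Or.inl h)
    · rcases le_or_gt ‖s‖ 2 with h' | h'
      · exact Or.inl (Or.inr ⟨h, h'⟩)
      · exact Or.inr h'.le
  -- the three bounds (finite constants)
  set IB : ℝ≥0∞ := ENNReal.ofReal 8 *
    (ENNReal.ofReal (3 * v₁ * ((1 / 2 : ℝ) ^ (3 - (σ - γ)) / (3 - (σ - γ)))) +
      ENNReal.ofReal (3 * v₁ * ((1 / 2 : ℝ) ^ (3 - σ) / (3 - σ)))) with hIB
  set IF : ℝ≥0∞ := ENNReal.ofReal 8 *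
    (ENNReal.ofReal (3 * v₁ * ((2 : ℝ) ^ (3 - (σ - γ + 3)) / (σ - γ + 3 - 3))) +
      ENNReal.ofReal (3 * v₁ * ((2 : ℝ) ^ (3 - (σ + 3)) / (σ + 3 - 3)))) with hIF
  set IM : ℝ≥0∞ := ENNReal.ofReal L * ENNReal.ofReal (3 * v₁ * ((4 : ℝ) ^ (3 - (2 : ℝ)) / (3 - 2)))
    with hIM
  have hIBtop : IB ≠ ⊤ := ENNReal.mul_ne_top ENNReal.ofReal_ne_top
    (ENNReal.add_ne_top.2 ⟨ENNReal.ofReal_ne_top, ENNReal.ofReal_ne_top⟩)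
  have hIFtop : IF ≠ ⊤ := ENNReal.mul_ne_top ENNReal.ofReal_ne_top
    (ENNReal.add_ne_top.2 ⟨ENNReal.ofReal_ne_top, ENNReal.ofReal_ne_top⟩)
  have hIMtop : IM ≠ ⊤ := ENNReal.mul_ne_top ENNReal.ofReal_ne_top ENNReal.ofReal_ne_top
  refine ⟨(IB + IM + IF).toNNReal, fun e he => ?_⟩
  rw [ENNReal.coe_toNNReal (ENNReal.add_ne_top.2 ⟨ENNReal.add_ne_top.2 ⟨hIBtop, hIMtop⟩, hIFtop⟩)]
  set f : ℝ³ → ℝ≥0∞ := fun s => ENNReal.ofReal (steinIntegrand γ σ e s) with hf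
  /- inner region -/
  have hIB' : ∫⁻ s in B, f s ≤ IB := by
    calc ∫⁻ s in B, f s ≤ ∫⁻ s in B, ENNReal.ofReal 8 *
          (ENNReal.ofReal (‖s‖ ^ (-(σ - γ))) + ENNReal.ofReal (‖s‖ ^ (-σ))) := by
          refine setLIntegral_mono' hBm fun s hs => ?_
          rw [hB, mem_ball_zero_iff] at hs
          simp only [hf]
          rw [← ENNReal.ofReal_add (by positivity) (by positivity), ← ENNReal.ofReal_mul (by norm_num)]
          exact ENNReal.ofReal_le_ofReal (steinIntegrand_le_of_norm_lt_half hσ he hs)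
      _ = ENNReal.ofReal 8 * ((∫⁻ s in B, ENNReal.ofReal (‖s‖ ^ (-(σ - γ)))) +
            ∫⁻ s in B, ENNReal.ofReal (‖s‖ ^ (-σ))) := by
          rw [lintegral_const_mul' _ _ ENNReal.ofReal_ne_top,
            lintegral_add_left ((measurable_norm.pow_const _).ennreal_ofReal)]
      _ = IB := by
          rw [hIB, hB, Literature.Analysis.FluidPDE.NewtonPotentialHolder.lintegral_ball_norm_rpow_neg hγ3 (by norm_num),
            Literature.Analysis.FluidPDE.NewtonPotentialHolder.lintegral_ball_norm_rpow_neg hσ3 (by norm_num)]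
  /- outer region -/
  have hIF' : ∫⁻ s in F, f s ≤ IF := by
    calc ∫⁻ s in F, f s ≤ ∫⁻ s in F, ENNReal.ofReal 8 *
          (ENNReal.ofReal (‖s‖ ^ (-(σ - γ + 3))) + ENNReal.ofReal (‖s‖ ^ (-(σ + 3)))) := by
          refine setLIntegral_mono' hFm fun s hs => ?_
          rw [hF, mem_compl_iff, mem_ball_zero_iff, not_lt] at hs
          simp only [hf]
          rw [← ENNReal.ofReal_add (by positivity) (by positivity), ← ENNReal.ofReal_mul (by norm_num)]
          exact ENNReal.ofReal_le_ofReal (steinIntegrand_le_of_two_le_norm he hs)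
      _ = ENNReal.ofReal 8 * ((∫⁻ s in F, ENNReal.ofReal (‖s‖ ^ (-(σ - γ + 3)))) +
            ∫⁻ s in F, ENNReal.ofReal (‖s‖ ^ (-(σ + 3)))) := by
          rw [lintegral_const_mul' _ _ ENNReal.ofReal_ne_top,
            lintegral_add_left ((measurable_norm.pow_const _).ennreal_ofReal)]
      _ = IF := by
          rw [hIF, hF, Literature.Analysis.FluidPDE.NewtonPotentialHolder.lintegral_compl_ball_norm_rpow_neg (by linarith) (by norm_num),
            Literature.Analysis.FluidPDE.NewtonPotentialHolder.lintegral_compl_ball_norm_rpow_neg (by linarith) (by norm_num)]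
  /- middle region -/
  have hIM' : ∫⁻ s in M, f s ≤ IM := by
    have hMsub : M ⊆ ball e 4 := by
      intro s hs
      rw [mem_ball, dist_eq_norm]
      calc ‖s - e‖ ≤ ‖s‖ + ‖e‖ := norm_sub_le _ _
        _ ≤ 2 + 1 := add_le_add hs.2 he.le
        _ < 4 := by norm_num
    calc ∫⁻ s in M, f s ≤ ∫⁻ s in M, ENNReal.ofReal L * ENNReal.ofReal (‖e - s‖ ^ (-(2 : ℝ))) := by
          refine setLIntegral_mono' hMm fun s hs => ?_
          simp only [hf]
          rw [← ENNReal.ofReal_mul (by positivity)]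
          exact ENNReal.ofReal_le_ofReal (steinIntegrand_le_of_mem_shell hσ he hs.1 hs.2)
      _ ≤ ∫⁻ s in ball e 4, ENNReal.ofReal L * ENNReal.ofReal (‖e - s‖ ^ (-(2 : ℝ))) :=
          lintegral_mono_set hMsub
      _ = ENNReal.ofReal L * ∫⁻ z in ball (0 : ℝ³) 4, ENNReal.ofReal (‖z‖ ^ (-(2 : ℝ))) := by
          rw [lintegral_const_mul' _ _ ENNReal.ofReal_ne_top,
            Literature.Analysis.FluidPDE.NewtonPotentialHolder.lintegral_ball_comp_sub_left (fun z => ENNReal.ofReal (‖z‖ ^ (-(2 : ℝ)))) e 4]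
      _ = IM := by
          rw [hIM, Literature.Analysis.FluidPDE.NewtonPotentialHolder.lintegral_ball_norm_rpow_neg (by norm_num) (by norm_num)]
  /- assembly -/
  calc ∫⁻ s, f s = ∫⁻ s in B ∪ M ∪ F, f s := by rw [hcover, setLIntegral_univ]
    _ ≤ (∫⁻ s in B ∪ M, f s) + ∫⁻ s in F, f s := lintegral_union_le _ _ _
    _ ≤ ((∫⁻ s in B, f s) + ∫⁻ s in M, f s) + ∫⁻ s in F, f s := by
        gcongr
        exact lintegral_union_le _ _ _
    _ ≤ IB + IM + IF := add_le_add (add_le_add hIB' hIM') hIF'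

end Angular

/-! ## §3. Scaling: the row and column integrals of Schur's test -/

section Scaling

/-- Change of variables `t = c s` (`c > 0`) on `ℝ³`: `∫ f = c³ ∫ f(c ·)`
(Mathlib `Measure.map_addHaar_smul`). [folklore] -/
theorem lintegral_eq_mul_lintegral_comp_smul (f : ℝ³ → ℝ≥0∞) {c : ℝ} (hc : 0 < c) :
    ∫⁻ t, f t = ENNReal.ofReal (c ^ 3) * ∫⁻ s, f (c • s) := by
  have hc0 : c ≠ 0 := hc.ne'
  let e : ℝ³ ≃ᵐ ℝ³ := (Homeomorph.smul (isUnit_iff_ne_zero.2 hc0).unit).toMeasurableEquiv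
  have he : (e : ℝ³ → ℝ³) = fun x => c • x := rfl
  have h1 : ∫⁻ s, f (c • s) = ENNReal.ofReal ((c ^ 3)⁻¹) * ∫⁻ t, f t := by
    calc ∫⁻ s, f (c • s) = ∫⁻ y, f y ∂(Measure.map (fun x => c • x) volume) := by
          rw [← he, lintegral_map_equiv]; rfl
      _ = ENNReal.ofReal ((c ^ 3)⁻¹) * ∫⁻ t, f t := by
          rw [Measure.map_addHaar_smul volume hc0, lintegral_smul_measure,
            finrank_euclideanSpace_fin, abs_of_nonneg (by positivity), smul_eq_mul]
  rw [h1, ← mul_assoc, ← ENNReal.ofReal_mul (by positivity), mul_inv_cancel₀ (by positivity),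
    ENNReal.ofReal_one, one_mul]

/-- The origin is a Lebesgue-null set of `ℝ³`: a.e. `s ≠ 0`. [folklore] -/
theorem ae_ne_zero : ∀ᵐ s ∂(volume : Measure ℝ³), s ≠ 0 := by
  have : ({(0 : ℝ³)} : Set ℝ³)ᶜ ∈ ae (volume : Measure ℝ³) :=
    compl_mem_ae_iff.2 (measure_singleton _)
  filter_upwards [this] with s hs
  simpa using hs

/-- The algebra of the scaling reduction: if `a a' = 1`, `S S' = 1` and `a', S' ≥ 0` then
`|a - a S| (a' S') = |S' - 1|`. [folklore] -/
theorem abs_sub_mul_mul_eq {a a' S S' : ℝ} (ha : a * a' = 1) (hS : S * S' = 1) (ha' : 0 ≤ a')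
    (hS' : 0 ≤ S') : |a - a * S| * (a' * S') = |S' - 1| := by
  rw [← abs_of_nonneg (mul_nonneg ha' hS'), ← abs_mul]
  congr 1
  linear_combination (S' - S * S') * ha - hS

/-- **Row integral** of Schur's test for Stein's kernel (substitution `t = |x| s`, homogeneity):
for `x ≠ 0`, `∫ K(x,t) |t|^{-σ} dt = |x|^{-σ} J_{-α,σ}(x/|x|)`. [cite: Stein1957, §2 (1)–(2)] -/
theorem lintegral_steinKernel_row (α σ : ℝ) {x : ℝ³} (hx : x ≠ 0) :
    ∫⁻ t, ENNReal.ofReal (steinKernel α x t) * ENNReal.ofReal (‖t‖ ^ (-σ)) =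
      ENNReal.ofReal (‖x‖ ^ (-σ)) *
        ∫⁻ s, ENNReal.ofReal (steinIntegrand (-α) σ (‖x‖⁻¹ • x) s) := by
  have hr : 0 < ‖x‖ := norm_pos_iff.2 hx
  set r : ℝ := ‖x‖ with hr_def
  set e : ℝ³ := r⁻¹ • x with he_def
  have he1 : ‖e‖ = 1 := by rw [he_def, norm_smul, norm_inv, Real.norm_eq_abs, abs_of_pos hr, ← hr_def,
    inv_mul_cancel₀ hr.ne']
  have hxe : x = r • e := by rw [he_def, smul_smul, mul_inv_cancel₀ hr.ne', one_smul]
  rw [lintegral_eq_mul_lintegral_comp_smul _ hr]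
  have hpt : ∀ s : ℝ³, s ≠ 0 →
      ENNReal.ofReal (steinKernel α x (r • s)) * ENNReal.ofReal (‖r • s‖ ^ (-σ)) =
        ENNReal.ofReal ((r ^ 3)⁻¹ * r ^ (-σ)) * ENNReal.ofReal (steinIntegrand (-α) σ e s) := by
    intro s hs
    have hsp : 0 < ‖s‖ := norm_pos_iff.2 hs
    rw [← ENNReal.ofReal_mul (steinKernel_nonneg _ _ _), ← ENNReal.ofReal_mul (by positivity)]
    congr 1
    simp only [steinKernel, steinIntegrand]
    rw [hxe, ← smul_sub, norm_smul r e, norm_smul r s, norm_smul r (e - s), Real.norm_eq_abs,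
      abs_of_pos hr, he1, mul_one, Real.mul_rpow hr.le hsp.le, Real.mul_rpow hr.le hsp.le,
      Real.mul_rpow hr.le hsp.le, mul_pow, mul_inv]
    have ha : r ^ α * r ^ (-α) = 1 := by rw [Real.rpow_neg hr.le, mul_inv_cancel₀ (Real.rpow_pos_of_pos hr _).ne']
    have hS : ‖s‖ ^ α * ‖s‖ ^ (-α) = 1 := by
      rw [Real.rpow_neg hsp.le, mul_inv_cancel₀ (Real.rpow_pos_of_pos hsp _).ne']
    have key := abs_sub_mul_mul_eq ha hS (Real.rpow_nonneg hr.le _) (Real.rpow_nonneg hsp.le _)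
    calc |r ^ α - r ^ α * ‖s‖ ^ α| * (r ^ (-α) * ‖s‖ ^ (-α)) * ((r ^ 3)⁻¹ * (‖e - s‖ ^ 3)⁻¹) *
          (r ^ (-σ) * ‖s‖ ^ (-σ))
        = (|r ^ α - r ^ α * ‖s‖ ^ α| * (r ^ (-α) * ‖s‖ ^ (-α))) *
            ((r ^ 3)⁻¹ * r ^ (-σ)) * (‖s‖ ^ (-σ) * (‖e - s‖ ^ 3)⁻¹) := by ring
      _ = (r ^ 3)⁻¹ * r ^ (-σ) * (|‖s‖ ^ (-α) - 1| * ‖s‖ ^ (-σ) * (‖e - s‖ ^ 3)⁻¹) := by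
          rw [key]; ring
  have hae : ∀ᵐ s ∂(volume : Measure ℝ³),
      ENNReal.ofReal (steinKernel α x (r • s)) * ENNReal.ofReal (‖r • s‖ ^ (-σ)) =
        ENNReal.ofReal ((r ^ 3)⁻¹ * r ^ (-σ)) * ENNReal.ofReal (steinIntegrand (-α) σ e s) := by
    filter_upwards [ae_ne_zero] with s hs
    exact hpt s hs
  rw [lintegral_congr_ae hae, lintegral_const_mul' _ _ ENNReal.ofReal_ne_top, ← mul_assoc,
    ← ENNReal.ofReal_mul (by positivity)]
  congr 2
  rw [← mul_assoc, mul_inv_cancel₀ (by positivity), one_mul]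

/-- **Column integral** of Schur's test for Stein's kernel (substitution `x = |t| s`):
for `t ≠ 0`, `∫ K(x,t) |x|^{-σ} dx = |t|^{-σ} J_{α,σ}(t/|t|)`. [cite: Stein1957, §2 (1)–(2)] -/
theorem lintegral_steinKernel_col (α σ : ℝ) {t : ℝ³} (ht : t ≠ 0) :
    ∫⁻ x, ENNReal.ofReal (steinKernel α x t) * ENNReal.ofReal (‖x‖ ^ (-σ)) =
      ENNReal.ofReal (‖t‖ ^ (-σ)) *
        ∫⁻ s, ENNReal.ofReal (steinIntegrand α σ (‖t‖⁻¹ • t) s) := by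
  have hr : 0 < ‖t‖ := norm_pos_iff.2 ht
  set r : ℝ := ‖t‖ with hr_def
  set e : ℝ³ := r⁻¹ • t with he_def
  have hte : t = r • e := by rw [he_def, smul_smul, mul_inv_cancel₀ hr.ne', one_smul]
  rw [lintegral_eq_mul_lintegral_comp_smul _ hr]
  have hpt : ∀ s : ℝ³,
      ENNReal.ofReal (steinKernel α (r • s) t) * ENNReal.ofReal (‖r • s‖ ^ (-σ)) =
        ENNReal.ofReal ((r ^ 3)⁻¹ * r ^ (-σ)) * ENNReal.ofReal (steinIntegrand α σ e s) := by
    intro s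
    rw [← ENNReal.ofReal_mul (steinKernel_nonneg _ _ _), ← ENNReal.ofReal_mul (by positivity)]
    congr 1
    simp only [steinKernel, steinIntegrand]
    have hrs : r • s - t = r • (s - e) := by rw [hte, smul_sub]
    rw [hrs, norm_smul, norm_smul, Real.norm_eq_abs, abs_of_pos hr, ← hr_def,
      Real.mul_rpow hr.le (norm_nonneg s), Real.mul_rpow hr.le (norm_nonneg s), mul_pow, mul_inv,
      norm_sub_rev s e]
    have ha : r ^ α * r ^ (-α) = 1 := by rw [Real.rpow_neg hr.le, mul_inv_cancel₀ (Real.rpow_pos_of_pos hr _).ne']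
    have h1 : |r ^ α * ‖s‖ ^ α - r ^ α| * r ^ (-α) = |‖s‖ ^ α - 1| := by
      rw [← abs_of_nonneg (Real.rpow_nonneg hr.le (-α)), ← abs_mul]
      congr 1
      linear_combination (‖s‖ ^ α - 1) * ha
    calc |r ^ α * ‖s‖ ^ α - r ^ α| * r ^ (-α) * ((r ^ 3)⁻¹ * (‖e - s‖ ^ 3)⁻¹) * (r ^ (-σ) * ‖s‖ ^ (-σ))
        = (|r ^ α * ‖s‖ ^ α - r ^ α| * r ^ (-α)) * ((r ^ 3)⁻¹ * r ^ (-σ)) *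
            (‖s‖ ^ (-σ) * (‖e - s‖ ^ 3)⁻¹) := by ring
      _ = (r ^ 3)⁻¹ * r ^ (-σ) * (|‖s‖ ^ α - 1| * ‖s‖ ^ (-σ) * (‖e - s‖ ^ 3)⁻¹) := by
          rw [h1]; ring
  simp_rw [hpt]
  rw [lintegral_const_mul' _ _ ENNReal.ofReal_ne_top, ← mul_assoc, ← ENNReal.ofReal_mul (by positivity)]
  congr 2
  rw [← mul_assoc, mul_inv_cancel₀ (by positivity), one_mul]

end Scaling

/-! ## §4. Stein's Lemma -/

section SteinLemma

/-- Power test functions: `ofReal(|x|^{-a})^q = ofReal(|x|^{-(a q)})`. [folklore] -/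
theorem ofReal_norm_rpow_neg_rpow (x : ℝ³) (a : ℝ) {q : ℝ} (hq : 0 ≤ q) :
    ENNReal.ofReal (‖x‖ ^ (-a)) ^ q = ENNReal.ofReal (‖x‖ ^ (-(a * q))) := by
  rw [ENNReal.ofReal_rpow_of_nonneg (Real.rpow_nonneg (norm_nonneg _) _) hq,
    ← Real.rpow_mul (norm_nonneg _), neg_mul]

/-- **Stein's Lemma on `ℝ³`** (Stein 1957, Lemma: "`‖U(f)‖_p ≤ A_{p,β} ‖f‖_p` if
`-n/p < β < n/p'`", `U(f)(x) = ∫ K(x,y) f(y) dy`, `K(x,y) = |1 - (|x|/|y|)^β|/|x-y|ⁿ`, `n = 3`), in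
`lintegral` form: for `1/p + 1/q = 1` and `-3/p < α < 3/q` there is `C = C(p, α)` with
`∫ (∫ K(x,t) f(t) dt)^p dx ≤ C ∫ f^p` for every measurable `f ≥ 0` (Schur's test with
`u = v = |x|^{-3/(pq)}`; rows reduce to `J_{-α,3/p}`, columns to `J_{α,3/q}`). [cite: Stein1957, Lemma p. 250–251] -/
theorem stein1957_lemma {p q : ℝ} (hpq : p.HolderConjugate q) {α : ℝ} (hα1 : -(3 / p) < α)
    (hα2 : α < 3 / q) :
    ∃ C : ℝ≥0, ∀ f : ℝ³ → ℝ≥0∞, Measurable f →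
      ∫⁻ x, (∫⁻ t, ENNReal.ofReal (steinKernel α x t) * f t) ^ p ≤ C * ∫⁻ t, f t ^ p := by
  have hp : 0 < p := hpq.pos
  have hq : 0 < q := hpq.symm.pos
  have hp1 : 1 < p := hpq.lt
  have hq1 : 1 < q := hpq.symm.lt
  have hinv : p⁻¹ + q⁻¹ = 1 := hpq.inv_add_inv_eq_one
  have h3q : 3 / q = 3 - 3 / p := by
    have : q⁻¹ = 1 - p⁻¹ := by linarith
    rw [div_eq_mul_inv, this, div_eq_mul_inv]; ring
  have h3p : 3 / p < 3 := by rw [div_lt_iff₀ hp]; nlinarith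
  have h3q' : 3 / q < 3 := by rw [div_lt_iff₀ hq]; nlinarith
  -- the two angular–radial constants
  obtain ⟨C₁, hC₁⟩ := exists_lintegral_steinIntegrand_le (γ := -α) (σ := 3 / p) (by positivity) h3p
    (by linarith) (by linarith)
  obtain ⟨C₂, hC₂⟩ := exists_lintegral_steinIntegrand_le (γ := α) (σ := 3 / q) (by positivity) h3q'
    (by linarith) (by linarith)
  refine ⟨C₁ ^ (p / q) * C₂, fun f hf => ?_⟩
  set a : ℝ := 3 / (p * q) with ha
  have haq : a * q = 3 / p := by rw [ha]; field_simp
  have hap : a * p = 3 / q := by rw [ha]; field_simp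
  set u : ℝ³ → ℝ≥0∞ := fun x => ENNReal.ofReal (‖x‖ ^ (-a)) with hu
  have hum : Measurable u := (measurable_norm.pow_const _).ennreal_ofReal
  have hu0 : ∀ᵐ y ∂(volume : Measure ℝ³), u y ≠ 0 := by
    filter_upwards [ae_ne_zero] with y hy
    simp only [hu]
    exact (ENNReal.ofReal_pos.2 (Real.rpow_pos_of_pos (norm_pos_iff.2 hy) _)).ne'
  have hutop : ∀ᵐ y ∂(volume : Measure ℝ³), u y ≠ ⊤ := Eventually.of_forall fun y => ENNReal.ofReal_ne_top
  have hK : Measurable (uncurry fun x t : ℝ³ => ENNReal.ofReal (steinKernel α x t)) :=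
    (measurable_steinKernel α).ennreal_ofReal
  -- rows
  have hrow : ∀ᵐ x ∂(volume : Measure ℝ³),
      ∫⁻ t, ENNReal.ofReal (steinKernel α x t) * u t ^ q ≤ C₁ * u x ^ q := by
    filter_upwards [ae_ne_zero] with x hx
    simp only [hu]
    simp_rw [ofReal_norm_rpow_neg_rpow _ a hq.le, haq]
    rw [lintegral_steinKernel_row α (3 / p) hx]
    have he : ‖‖x‖⁻¹ • x‖ = 1 := by
      rw [norm_smul, norm_inv, norm_norm, inv_mul_cancel₀ (norm_pos_iff.2 hx).ne']
    calc ENNReal.ofReal (‖x‖ ^ (-(3 / p))) * ∫⁻ s, ENNReal.ofReal (steinIntegrand (-α) (3 / p) (‖x‖⁻¹ • x) s)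
        ≤ ENNReal.ofReal (‖x‖ ^ (-(3 / p))) * C₁ := by gcongr; exact hC₁ _ he
      _ = C₁ * ENNReal.ofReal (‖x‖ ^ (-(3 / p))) := mul_comm _ _
  -- columns
  have hcol : ∀ᵐ t ∂(volume : Measure ℝ³),
      ∫⁻ x, ENNReal.ofReal (steinKernel α x t) * u x ^ p ≤ C₂ * u t ^ p := by
    filter_upwards [ae_ne_zero] with t ht
    simp only [hu]
    simp_rw [ofReal_norm_rpow_neg_rpow _ a hp.le, hap]
    rw [lintegral_steinKernel_col α (3 / q) ht]
    have he : ‖‖t‖⁻¹ • t‖ = 1 := by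
      rw [norm_smul, norm_inv, norm_norm, inv_mul_cancel₀ (norm_pos_iff.2 ht).ne']
    calc ENNReal.ofReal (‖t‖ ^ (-(3 / q))) * ∫⁻ s, ENNReal.ofReal (steinIntegrand α (3 / q) (‖t‖⁻¹ • t) s)
        ≤ ENNReal.ofReal (‖t‖ ^ (-(3 / q))) * C₂ := by gcongr; exact hC₂ _ he
      _ = C₂ * ENNReal.ofReal (‖t‖ ^ (-(3 / q))) := mul_comm _ _
  have h := lintegral_rpow_lintegral_le_of_schur (μ := (volume : Measure ℝ³)) (ν := (volume : Measure ℝ³))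
    hpq hK hum hum hu0 hutop hrow hcol hf
  refine h.trans (le_of_eq ?_)
  rw [ENNReal.coe_mul, ENNReal.coe_rpow_of_nonneg _ (by positivity)]

end SteinLemma

/-! ## §5. Stein's Theorem: power weights from the unweighted bound -/

section Extension

universe u

variable {E : Type u} [NormedAddCommGroup E] [NormedSpace ℝ E] [FiniteDimensional ℝ E]
  [MeasurableSpace E] [BorelSpace E] {μ : Measure E} [μ.IsAddHaarMeasure]

/-- **Extension to unbounded integrable functions** (the step "`T` extends to all of `L^p`",
Stein 1970 Ch. II §2.2, in the form needed for `|t|^α f`, `α < 0`): if `‖Tf‖_p ≤ A‖f‖_p` for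
bounded compactly supported measurable `f` (`Tf = ∫ f(t)k(·-t)dt`, `k` bounded measurable), then
the same holds for integrable compactly supported measurable `f` (truncate `f` at height `n`,
dominated convergence pointwise in `x`, Fatou in `L^p`). [cite: Stein1971, Ch. II §2.2 Thm 1] -/
theorem eLpNorm_le_of_integrable {k : E → ℝ} (hk : Measurable k) {M : ℝ}
    (hM : ∀ x, |k x| ≤ M) {p : ℝ≥0∞} {A : ℝ≥0∞}
    (hA : ∀ f : E → ℝ, Measurable f → (∃ C, ∀ x, |f x| ≤ C) → HasCompactSupport f →
      eLpNorm (fun x => ∫ t, f t * k (x - t) ∂μ) p μ ≤ A * eLpNorm f p μ)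
    {f : E → ℝ} (hf : Measurable f) (hfi : Integrable f μ) (hfc : HasCompactSupport f) :
    eLpNorm (fun x => ∫ t, f t * k (x - t) ∂μ) p μ ≤ A * eLpNorm f p μ := by
  have hM0 : 0 ≤ M := (abs_nonneg _).trans (hM 0)
  -- truncations at height `n`
  set fn : ℕ → E → ℝ := fun n t => max (-(n : ℝ)) (min (f t) n) with hfn
  have hfn_m : ∀ n, Measurable (fn n) := fun n => measurable_const.max (hf.min measurable_const)
  have hfn_bdd : ∀ n t, |fn n t| ≤ n := fun n t =>
    abs_le.2 ⟨le_max_left _ _, max_le (by linarith [n.cast_nonneg (α := ℝ)]) (min_le_right _ _)⟩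
  have hfn_abs : ∀ n t, |fn n t| ≤ |f t| := by
    intro n t
    simp only [hfn]
    rcases le_total (f t) n with h1 | h1
    · rw [min_eq_left h1]
      rcases le_total (-(n : ℝ)) (f t) with h2 | h2
      · rw [max_eq_right h2]
      · rw [max_eq_left h2, abs_neg, Nat.abs_cast]
        have : (n : ℝ) ≤ -f t := by linarith
        exact this.trans (neg_le_abs _)
    · rw [min_eq_right h1, max_eq_right (by linarith [n.cast_nonneg (α := ℝ)]), Nat.abs_cast]
      exact h1.trans (le_abs_self _)
  have hfn_supp : ∀ n, HasCompactSupport (fn n) := fun n =>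
    hfc.mono fun t ht => by
      contrapose! ht
      rw [notMem_support] at ht ⊢
      simp only [hfn, ht]
      rw [min_eq_left (Nat.cast_nonneg n), max_eq_right (neg_nonpos.2 (Nat.cast_nonneg n))]
  have hfn_lim : ∀ t, Tendsto (fun n => fn n t) atTop (𝓝 (f t)) := by
    intro t
    refine tendsto_const_nhds.congr' ?_
    filter_upwards [eventually_ge_atTop ⌈|f t|⌉₊] with n hn
    have hn' : |f t| ≤ n := (Nat.le_ceil _).trans (Nat.cast_le.2 hn)
    simp only [hfn]
    rw [min_eq_left ((le_abs_self _).trans hn'), max_eq_right (by linarith [neg_abs_le (f t)])]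
  -- pointwise convergence of `T fₙ` by dominated convergence
  have hT_lim : ∀ x, Tendsto (fun n => ∫ t, fn n t * k (x - t) ∂μ) atTop (𝓝 (∫ t, f t * k (x - t) ∂μ)) := by
    intro x
    refine tendsto_integral_of_dominated_convergence (fun t => M * |f t|)
      (fun n => (integrable_mul_kernel hk hM
        (integrable_of_bdd_of_hasCompactSupport (hfn_m n) (hfn_bdd n) (hfn_supp n)) x).aestronglyMeasurable)
      (hfi.abs.const_mul M) (fun n => Eventually.of_forall fun t => ?_)
      (Eventually.of_forall fun t => ((hfn_lim t).mul tendsto_const_nhds))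
    rw [Real.norm_eq_abs, abs_mul, mul_comm]
    exact mul_le_mul (hM _) (hfn_abs n t) (abs_nonneg _) hM0
  -- Fatou
  have hFatou := Lp.eLpNorm_lim_le_liminf_eLpNorm (μ := μ) (p := p)
    (f := fun n x => ∫ t, fn n t * k (x - t) ∂μ)
    (fun n => (stronglyMeasurable_integral_mul_kernel hk (hfn_m n)).aestronglyMeasurable)
    (fun x => ∫ t, f t * k (x - t) ∂μ) (Eventually.of_forall hT_lim)
  refine hFatou.trans (liminf_le_of_frequently_le' (Eventually.of_forall fun n => ?_).frequently)
  calc eLpNorm (fun x => ∫ t, fn n t * k (x - t) ∂μ) p μ ≤ A * eLpNorm (fn n) p μ :=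
        hA (fn n) (hfn_m n) ⟨n, hfn_bdd n⟩ (hfn_supp n)
    _ ≤ A * eLpNorm f p μ := by
        gcongr
        exact eLpNorm_mono fun t => by rw [Real.norm_eq_abs, Real.norm_eq_abs]; exact hfn_abs n t

end Extension

section SteinTheorem

/-- Two points form a null set: a.e. `t ≠ 0` and `t ≠ x`. [folklore] -/
theorem ae_ne_zero_and_ne (x : ℝ³) : ∀ᵐ t ∂(volume : Measure ℝ³), t ≠ 0 ∧ t ≠ x := by
  have h0 : ({(0 : ℝ³)} : Set ℝ³)ᶜ ∈ ae (volume : Measure ℝ³) := compl_mem_ae_iff.2 (measure_singleton _)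
  have hx : ({x} : Set ℝ³)ᶜ ∈ ae (volume : Measure ℝ³) := compl_mem_ae_iff.2 (measure_singleton _)
  filter_upwards [h0, hx] with t h1 h2
  exact ⟨by simpa using h1, by simpa using h2⟩

/-- `|t|^α h` is integrable for `α > -3` and `h` bounded, compactly supported, measurable. [folklore] -/
theorem integrable_norm_rpow_mul {α : ℝ} (hα : -3 < α) {h : ℝ³ → ℝ} (hh : Measurable h)
    {C : ℝ} (hC : ∀ x, |h x| ≤ C) (hhc : HasCompactSupport h) :
    Integrable (fun t : ℝ³ => ‖t‖ ^ α * h t) := by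
  obtain ⟨R, hR⟩ : ∃ R : ℝ, tsupport h ⊆ closedBall (0 : ℝ³) R :=
    hhc.isCompact.isBounded.subset_closedBall 0
  have hC0 : 0 ≤ C := (abs_nonneg _).trans (hC 0)
  have hzero : ∀ t, t ∉ ball (0 : ℝ³) (R + 1) → ‖t‖ ^ α * h t = 0 := by
    intro t ht
    have : t ∉ tsupport h := fun h' => ht (closedBall_subset_ball (lt_add_one R) (hR h'))
    rw [image_eq_zero_of_notMem_tsupport this, mul_zero]
  refine IntegrableOn.integrable_of_forall_notMem_eq_zero ?_ hzero
  have hI : IntegrableOn (fun t : ℝ³ => C * ‖t‖ ^ (-(-α))) (ball 0 (R + 1)) volume :=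
    (Literature.Analysis.FluidPDE.NewtonPotentialHolder.integrableOn_ball_norm_rpow_neg (by linarith) _).const_mul C
  refine hI.mono' (((measurable_norm.pow_const α).mul hh).aestronglyMeasurable) (Eventually.of_forall fun t => ?_)
  rw [neg_neg, Real.norm_eq_abs, abs_mul, abs_of_nonneg (Real.rpow_nonneg (norm_nonneg _) _), mul_comm]
  exact mul_le_mul_of_nonneg_right (hC t) (Real.rpow_nonneg (norm_nonneg _) _)

/-- **The commutator is dominated by Stein's positive operator** (Stein 1957, §3:
`|F*(x) - |x|^α F(x)| ≤ A ∫ K(x,y) |y|^α |f(y)| dy`): for `|k(z)| ≤ A|z|⁻³`,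
`‖|x|^α ∫ h(t)k(x-t)dt‖ ≤ ‖∫ |t|^α h(t) k(x-t) dt‖ + A ∫ K(x,t) |t|^α |h(t)| dt`. [cite: Stein1957, §3 p. 254] -/
theorem enorm_rpow_mul_integral_le {k : ℝ³ → ℝ} (hk : Measurable k) {M : ℝ} (hM : ∀ z, |k z| ≤ M)
    {A : ℝ≥0} (hA : ∀ z, z ≠ 0 → |k z| ≤ A * (‖z‖ ^ 3)⁻¹) {α : ℝ} (hα : -3 < α) {h : ℝ³ → ℝ}
    (hh : Measurable h) {C : ℝ} (hC : ∀ x, |h x| ≤ C) (hhc : HasCompactSupport h) (x : ℝ³) :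
    ‖‖x‖ ^ α * ∫ t, h t * k (x - t)‖ₑ ≤
      ‖∫ t, (‖t‖ ^ α * h t) * k (x - t)‖ₑ +
        A * ∫⁻ t, ENNReal.ofReal (steinKernel α x t) * ‖‖t‖ ^ α * h t‖ₑ := by
  have hhi : Integrable h := integrable_of_bdd_of_hasCompactSupport hh hC hhc
  have hgi : Integrable (fun t : ℝ³ => ‖t‖ ^ α * h t) := integrable_norm_rpow_mul hα hh hC hhc
  have hI1 : Integrable (fun t => h t * k (x - t)) := integrable_mul_kernel hk hM hhi x
  have hI2 : Integrable (fun t => (‖t‖ ^ α * h t) * k (x - t)) := integrable_mul_kernel hk hM hgi x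
  -- the commutator identity
  have hcomm : ‖x‖ ^ α * (∫ t, h t * k (x - t)) - (∫ t, (‖t‖ ^ α * h t) * k (x - t)) =
      ∫ t, (‖x‖ ^ α - ‖t‖ ^ α) * h t * k (x - t) := by
    rw [← integral_const_mul, ← integral_sub (hI1.const_mul _) hI2]
    exact integral_congr_ae (Eventually.of_forall fun t => by ring)
  -- pointwise domination of the commutator integrand, a.e.
  have hdom : ∀ᵐ t ∂(volume : Measure ℝ³), ‖(‖x‖ ^ α - ‖t‖ ^ α) * h t * k (x - t)‖ₑ ≤
      A * (ENNReal.ofReal (steinKernel α x t) * ‖‖t‖ ^ α * h t‖ₑ) := by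
    filter_upwards [ae_ne_zero_and_ne x] with t ht
    have htp : 0 < ‖t‖ := norm_pos_iff.2 ht.1
    have hxt : x - t ≠ 0 := sub_ne_zero.2 (Ne.symm ht.2)
    rw [Real.enorm_eq_ofReal_abs, Real.enorm_eq_ofReal_abs, ← ENNReal.ofReal_mul (steinKernel_nonneg _ _ _),
      show (A : ℝ≥0∞) = ENNReal.ofReal A by rw [ENNReal.ofReal_coe_nnreal],
      ← ENNReal.ofReal_mul A.coe_nonneg]
    refine ENNReal.ofReal_le_ofReal ?_
    rw [abs_mul, abs_mul]
    calc |‖x‖ ^ α - ‖t‖ ^ α| * |h t| * |k (x - t)|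
        ≤ |‖x‖ ^ α - ‖t‖ ^ α| * |h t| * (A * (‖x - t‖ ^ 3)⁻¹) := by gcongr; exact hA _ hxt
      _ = A * (steinKernel α x t * |‖t‖ ^ α * h t|) := by
          simp only [steinKernel]
          rw [abs_mul, abs_of_nonneg (Real.rpow_nonneg htp.le α)]
          have hS : ‖t‖ ^ (-α) * ‖t‖ ^ α = 1 := by
            rw [Real.rpow_neg htp.le, inv_mul_cancel₀ (Real.rpow_pos_of_pos htp _).ne']
          linear_combination (-(|‖x‖ ^ α - ‖t‖ ^ α| * |h t| * (A : ℝ) * (‖x - t‖ ^ 3)⁻¹)) * hS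
  -- assemble
  have hsplit : ‖x‖ ^ α * (∫ t, h t * k (x - t)) =
      (∫ t, (‖t‖ ^ α * h t) * k (x - t)) + ∫ t, (‖x‖ ^ α - ‖t‖ ^ α) * h t * k (x - t) := by
    rw [← hcomm]; ring
  rw [hsplit]
  refine (enorm_add_le _ _).trans (add_le_add le_rfl ?_)
  calc ‖∫ t, (‖x‖ ^ α - ‖t‖ ^ α) * h t * k (x - t)‖ₑ
      ≤ ∫⁻ t, ‖(‖x‖ ^ α - ‖t‖ ^ α) * h t * k (x - t)‖ₑ := enorm_integral_le_lintegral_enorm _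
    _ ≤ ∫⁻ t, A * (ENNReal.ofReal (steinKernel α x t) * ‖‖t‖ ^ α * h t‖ₑ) := lintegral_mono_ae hdom
    _ = A * ∫⁻ t, ENNReal.ofReal (steinKernel α x t) * ‖‖t‖ ^ α * h t‖ₑ :=
        lintegral_const_mul' _ _ ENNReal.coe_ne_top

/-- **Stein's theorem on power weights, `ℝ³`** (Stein 1957, Theorem: "`‖(Tf)(x)|x|^β‖_p ≤
A_{p,β} ‖f(x)|x|^β‖_p`, `-n/p < β < n/p'`", for `T` with `‖T(f)‖_p ≤ A_p‖f‖_p` and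
`|H(x,x-y)| ≤ A`). Let `1/p + 1/q = 1` and `-3/p < α < 3/q`. There is `C = C(p, α)` such that
for every bounded measurable kernel `k` with `|k(z)| ≤ A|z|⁻³` (`z ≠ 0`) whose operator
`Tf = ∫ f(t)k(·-t)dt` satisfies `‖Tf‖_p ≤ C_p‖f‖_p` for all bounded compactly supported
measurable `f`, and every such `h`: `‖|x|^α T h‖_p ≤ (C_p + A C) ‖|x|^α h‖_p` (§3 of the paper:
`|x|^α Th = T(|·|^α h) + [commutator]`, the commutator is dominated by `A ∫ K(x,t)|t|^α|h(t)|dt`,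
and Stein's Lemma; `T(|·|^α h)` by the hypothesis extended to integrable `f`,
`eLpNorm_le_of_integrable`). [cite: Stein1957, Theorem p. 250 and §3] -/
theorem stein1957_powerWeight {p q : ℝ} (hpq : p.HolderConjugate q) {α : ℝ} (hα1 : -(3 / p) < α)
    (hα2 : α < 3 / q) :
    ∃ C : ℝ≥0, ∀ {k : ℝ³ → ℝ}, Measurable k → ∀ {M : ℝ}, (∀ z, |k z| ≤ M) →
      ∀ {A : ℝ≥0}, (∀ z, z ≠ 0 → |k z| ≤ A * (‖z‖ ^ 3)⁻¹) →
      ∀ {Cp : ℝ≥0∞}, (∀ f : ℝ³ → ℝ, Measurable f → (∃ C', ∀ x, |f x| ≤ C') → HasCompactSupport f →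
          eLpNorm (fun x => ∫ t, f t * k (x - t)) (ENNReal.ofReal p) volume ≤
            Cp * eLpNorm f (ENNReal.ofReal p) volume) →
      ∀ (h : ℝ³ → ℝ), Measurable h → (∃ C', ∀ x, |h x| ≤ C') → HasCompactSupport h →
        eLpNorm (fun x => ‖x‖ ^ α * ∫ t, h t * k (x - t)) (ENNReal.ofReal p) volume ≤
          (Cp + A * C) * eLpNorm (fun x => ‖x‖ ^ α * h x) (ENNReal.ofReal p) volume := by
  have hp : 0 < p := hpq.pos
  have hp1 : 1 ≤ p := hpq.lt.le
  have h3p : -3 < α := by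
    have : 3 / p ≤ 3 := by rw [div_le_iff₀ hp]; nlinarith
    linarith
  obtain ⟨CS, hCS⟩ := stein1957_lemma hpq hα1 hα2
  refine ⟨CS ^ (1 / p), ?_⟩
  intro k hk M hM A hA Cp hCp h hh hhb hhc
  obtain ⟨C', hC'⟩ := hhb
  have hp0 : ENNReal.ofReal p ≠ 0 := (ENNReal.ofReal_pos.2 hp).ne'
  have hptop : ENNReal.ofReal p ≠ ⊤ := ENNReal.ofReal_ne_top
  have htoReal : (ENNReal.ofReal p).toReal = p := ENNReal.toReal_ofReal hp.le
  set g : ℝ³ → ℝ := fun t => ‖t‖ ^ α * h t with hg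
  have hgm : Measurable g := (measurable_norm.pow_const α).mul hh
  have hgi : Integrable g := integrable_norm_rpow_mul h3p hh hC' hhc
  have hgc : HasCompactSupport g := hhc.mono fun t ht => by
    contrapose! ht
    rw [notMem_support] at ht ⊢
    simp [hg, ht]
  -- the unweighted bound for `T g` (extension to the integrable `g`)
  have hTg : eLpNorm (fun x => ∫ t, g t * k (x - t)) (ENNReal.ofReal p) volume ≤
      Cp * eLpNorm g (ENNReal.ofReal p) volume :=
    eLpNorm_le_of_integrable hk hM hCp hgm hgi hgc
  -- Stein's positive operator applied to `|g|`
  set S : ℝ³ → ℝ≥0∞ := fun x => ∫⁻ t, ENNReal.ofReal (steinKernel α x t) * ‖g t‖ₑ with hS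
  have hSm : Measurable S :=
    ((measurable_steinKernel α).ennreal_ofReal.mul (hgm.comp measurable_snd).enorm).lintegral_prod_right
  have hSp : ∫⁻ x, S x ^ p ≤ CS * ∫⁻ t, ‖g t‖ₑ ^ p := hCS (fun t => ‖g t‖ₑ) hgm.enorm
  -- measurability of `T g`
  have hTgm : Measurable fun x => ∫ t, g t * k (x - t) :=
    (stronglyMeasurable_integral_mul_kernel hk hgm).measurable
  -- pointwise: `‖|x|^α T h x‖ ≤ ‖T g x‖ + A S x`
  have hpt : ∀ x, ‖‖x‖ ^ α * ∫ t, h t * k (x - t)‖ₑ ≤ ‖∫ t, g t * k (x - t)‖ₑ + A * S x :=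
    fun x => enorm_rpow_mul_integral_le hk hM hA h3p hh hC' hhc x
  -- `L^p` norms via lintegrals
  rw [eLpNorm_eq_lintegral_rpow_enorm_toReal hp0 hptop, eLpNorm_eq_lintegral_rpow_enorm_toReal hp0 hptop,
    htoReal]
  rw [eLpNorm_eq_lintegral_rpow_enorm_toReal hp0 hptop, eLpNorm_eq_lintegral_rpow_enorm_toReal hp0 hptop,
    htoReal] at hTg
  calc (∫⁻ x, ‖‖x‖ ^ α * ∫ t, h t * k (x - t)‖ₑ ^ p) ^ (1 / p)
      ≤ (∫⁻ x, ((fun x => ‖∫ t, g t * k (x - t)‖ₑ) + fun x => (A : ℝ≥0∞) * S x) x ^ p) ^ (1 / p) := by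
        gcongr with x
        exact hpt x
    _ ≤ (∫⁻ x, ‖∫ t, g t * k (x - t)‖ₑ ^ p) ^ (1 / p) + (∫⁻ x, ((A : ℝ≥0∞) * S x) ^ p) ^ (1 / p) :=
        ENNReal.lintegral_Lp_add_le hTgm.enorm.aemeasurable (hSm.const_mul _).aemeasurable hp1
    _ ≤ Cp * (∫⁻ x, ‖g x‖ₑ ^ p) ^ (1 / p) + A * (CS * ∫⁻ t, ‖g t‖ₑ ^ p) ^ (1 / p) := by
        refine add_le_add hTg ?_
        calc (∫⁻ x, ((A : ℝ≥0∞) * S x) ^ p) ^ (1 / p) = (A : ℝ≥0∞) * (∫⁻ x, S x ^ p) ^ (1 / p) := by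
              simp_rw [ENNReal.mul_rpow_of_nonneg _ _ hp.le]
              rw [lintegral_const_mul _ (hSm.pow_const _), ENNReal.mul_rpow_of_nonneg _ _ (by positivity),
                ← ENNReal.rpow_mul, mul_one_div_cancel hp.ne', ENNReal.rpow_one]
          _ ≤ A * (CS * ∫⁻ t, ‖g t‖ₑ ^ p) ^ (1 / p) := by gcongr
    _ = (Cp + A * (CS ^ (1 / p) : ℝ≥0)) * (∫⁻ x, ‖g x‖ₑ ^ p) ^ (1 / p) := by
        rw [ENNReal.mul_rpow_of_nonneg _ _ (by positivity), ENNReal.coe_rpow_of_nonneg _ (by positivity)]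
        ring

end SteinTheorem

end Literature.Analysis.SingularIntegrals

end
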